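import Mathlib
import Summits.NavierStokesRegularity.NavierStokesRegularity.Theorems.EulerZoomLiouvillePowerGaugeEulerLiouvilleDriftClockInvariantMember
import HarnessLib

/-!
# «ANY INWARD DRIFT KILLS», X (K-w1-LEVEL): «ONE LEVEL AT ONE VORTICAL POINT KILLS» — the band deficit above ONE Bernoulli level through ONE vortical point clocks that point
# (crux `EulerZoomLiouville.PowerGaugeEulerLiouville` = stmt-NavierStokesRegularity-19832, THE ONE STATEMENT `stub_selfSimilarC2Needle`; LEAD key K-w1-LEVEL 2026-08-28, `HasFastVorticalChannel` alt 10)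

Route `EulerZoomLiouville` (NavierStokesRegularity), crux E; width seat ns-ezl-w1 g6 on the LEAD's key K-w1-LEVEL (ns-typeII-p2 g13).  The engines
`DriftClock.powerClock_of_scaleBandDeficit` / `…_of_widePowerBandDeficit` (and the LEAD's `…_of_decayingBandDeficit`, `ChannelClock.logClock_of_channel`)
consume `hdef : ∀ h, ∃ R₀, …` ONLY at the single level `h = ℋ(x₀) − 1` of the blob centre and produce the clock AT `x₀`; since v88 a clock at ONE ball kills
(`NeedleRace.selfSimilar_ae_eq_zero_of_localPowerClockC2`).  Here the level is a datum: ONE vortical `x₀`, ONE level `h < ℋ_{P′}(x₀)`, and the scale-indexed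
(resp. power-law) band deficit on the far vortical part of `{ℋ_{P′} > h}` — the instance `O = {ℋ_{P′} > h}` of the level-free engine
`DriftClock.powerClockAt_of_invariantBandDeficit` (`…DriftClockInvariant`: open by continuity of `ℋ`, backward-invariant by
`DriftClock.backwardInvariant_bernoulliSuperlevel`).  Notation: `W y = γy + V y`, `γ = 1/(2+ρ)`, `ℛ = ⟪y, W y⟫`, `a(y) = ‖W y‖² + γℛ + ⟪y, DV(y)(W y)⟫`.

* `DriftClock.powerClockAt_of_scaleBandDeficit_level` — scale-indexed `κ(R)`, `a(R)` + budget, at one level through one vortical point ⇒ clock AT that point.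
* `DriftClock.powerClockAt_of_powerBandDeficit_level` — power-law `κb‖y‖^{−p}`, `a₀‖y‖^{−q}`, `0 ≤ p < ρ`, `0 ≤ q < 2+ρ+p`, idem.
* **`Loc.selfSimilar_ae_eq_zero_of_powerBandDeficitC2_level`** / **`Past.selfSimilar_ae_eq_zero_of_powerBandDeficitC2_level_past`** — members (crux hypotheses
  verbatim, `0 < ρ ≤ ½`, exact self-similarity about the origin / about `(T, x₀)` for `τ < T₁`, `V ∈ C²`): for every classical pressure `P′` SOME vortical `x₀`,
  SOME level `h < ℋ_{P′}(x₀)` and a radius beyond which every vortical point of `{ℋ_{P′} > h}` in the band `−κb‖y‖^{−e₁} ≤ ℛ ≤ 0` has `a ≥ a₀‖y‖^{−e₂}`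
  ⇒ `u = 0` a.e.  ⊇ alternative 9 (`∀ h`).  PORTRAIT GAIN (LEAD): the needle carries circular, centripetally balanced vortical cells ABOVE EVERY VORTICAL
  BERNOULLI LEVEL, hence at arbitrarily high Bernoulli values on the `sup_{curl ≠ 0} ℋ = +∞` branch.

WHAT THIS IS NOT: not NS, not E — corollaries + strata on the model lattice; DENT 0 on the registered stubs; 19832 OPEN; NS regularity is NOT proved; no summit
statement is proved by this seat. [folklore; ConstantinIgnatovaVicol2026Putative §3.4–§3.5]
-/
noncomputable section

-- flat `Theorems/<Route><Decl>…` files of one crux share the namespace of the crux (tree convention: `Summit.<S>.<S>.…`)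
set_option linter.dupNamespace false

open Set Filter Topology Metric Function MeasureTheory
open scoped RealInnerProductSpace NNReal ENNReal

namespace Summit.NavierStokesRegularity.NavierStokesRegularity.Theorems.PowerGaugeEulerLiouville

open Literature.Analysis Literature.Analysis.FluidPDE

namespace DriftClock

/-- **ONE LEVEL AT ONE VORTICAL POINT, scale-indexed form**: a vortical `x₀`, a level `h < ℋ_{P′}(x₀)`, the scale-indexed band deficit on the far vortical part of
`{ℋ_{P′} > h}` and the budget `2κ(R)/a(R) + 3R²/κ(R) ≤ c′R^{2+ρ}` eventually ⇒ the power residence clock AT `x₀` (every `c′ > 0`).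
= `powerClockAt_of_invariantBandDeficit` at `O = {ℋ_{P′} > h}`. [folklore; ConstantinIgnatovaVicol2026Putative §3.4–§3.5] -/
theorem powerClockAt_of_scaleBandDeficit_level {ρ : ℝ} (hρ : 0 < ρ) (hρh : ρ ≤ 1 / 2)
    {V : EuclideanSpace ℝ (Fin 3) → EuclideanSpace ℝ (Fin 3)} {P' : EuclideanSpace ℝ (Fin 3) → ℝ}
    (hprof : IsSelfSimilarEulerProfile (1 / (2 + ρ)) 0 V P') {κ a : ℝ → ℝ} (hκ : ∀ R : ℝ, 0 < R → 0 < κ R)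
    (ha : ∀ R : ℝ, 0 < R → 0 < a R) {x₀ : EuclideanSpace ℝ (Fin 3)} (hx₀ : curl V x₀ ≠ 0) {h : ℝ}
    (hh : h < selfSimilarBernoulli (1 / (2 + ρ)) 0 V P' x₀)
    (hdef : ∃ R₀ : ℝ, ∀ (R : ℝ) (y : EuclideanSpace ℝ (Fin 3)), R₀ ≤ ‖y‖ → ‖y‖ ≤ 2 * R →
      h < selfSimilarBernoulli (1 / (2 + ρ)) 0 V P' y → curl V y ≠ 0 →
        -κ R ≤ ⟪y, selfSimilarTransport (1 / (2 + ρ)) 0 V y⟫ → ⟪y, selfSimilarTransport (1 / (2 + ρ)) 0 V y⟫ ≤ 0 →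
        a R ≤ ‖selfSimilarTransport (1 / (2 + ρ)) 0 V y‖ ^ 2 +
          (1 / (2 + ρ)) * ⟪y, selfSimilarTransport (1 / (2 + ρ)) 0 V y⟫ +
          ⟪y, fderiv ℝ V y (selfSimilarTransport (1 / (2 + ρ)) 0 V y)⟫)
    (hbudget : ∀ c' : ℝ, 0 < c' → ∀ᶠ R : ℝ in atTop, 2 * κ R / a R + 3 * R ^ 2 / κ R ≤ c' * R ^ (2 + ρ)) :
    ∀ c' : ℝ, 0 < c' → ∃ r : ℝ, 0 < r ∧ ∃ R₀ : ℝ,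
      ∀ R : ℝ, R₀ ≤ R → ∀ (V' : EuclideanSpace ℝ (Fin 3) → EuclideanSpace ℝ (Fin 3)) (K Rbig : ℝ), ContDiff ℝ 2 V' →
        (∀ y, ‖fderiv ℝ V' y‖ ≤ K) → 2 * R < Rbig →
        (∀ w ∈ ball (0 : EuclideanSpace ℝ (Fin 3)) Rbig, V' w = V w) →
        (volume (ball x₀ r ∩ {y | ∀ σ ∈ Icc 0 (c' * R ^ (2 + ρ)),
          ‖ODE.evolutionMap (fun _ : ℝ => selfSimilarTransport (1 / (2 + ρ)) 0 V') 0 (-σ) y‖ ≤ 2 * R})).toReal ≤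
          (volume (ball x₀ r)).toReal / 2 := by
  obtain ⟨R₀, hR₀⟩ := hdef
  have hγ2 : 1 / (2 + ρ) ≤ 1 / 2 := one_div_le_one_div_of_le two_pos (by linarith)
  exact powerClockAt_of_invariantBandDeficit hρ hρh hprof (O := {y | h < selfSimilarBernoulli (1 / (2 + ρ)) 0 V P' y})
    (isOpen_lt continuous_const hprof.contDiff_selfSimilarBernoulli.continuous)
    (backwardInvariant_bernoulliSuperlevel hprof hγ2 h) hκ ha
    (fun R y hyO hy1 hy2 hc hlo hhi => hR₀ R y hy1 hy2 hyO hc hlo hhi) hbudget hh hx₀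

/-- **ONE LEVEL AT ONE VORTICAL POINT, power-law form** (`0 ≤ p < ρ`, `0 ≤ q < 2+ρ+p`): a vortical `x₀`, a level `h < ℋ_{P′}(x₀)` and a radius beyond which every
vortical point of `{ℋ_{P′} > h}` in the band `−κb‖y‖^{−p} ≤ ℛ ≤ 0` has `a ≥ a₀‖y‖^{−q}` ⇒ the power residence clock AT `x₀` (every `c′ > 0`).
= `powerClockAt_of_invariantPowerBandDeficit` at `O = {ℋ_{P′} > h}`. [folklore; ConstantinIgnatovaVicol2026Putative §3.4–§3.5] -/
theorem powerClockAt_of_powerBandDeficit_level {ρ : ℝ} (hρ : 0 < ρ) (hρh : ρ ≤ 1 / 2)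
    {V : EuclideanSpace ℝ (Fin 3) → EuclideanSpace ℝ (Fin 3)} {P' : EuclideanSpace ℝ (Fin 3) → ℝ}
    (hprof : IsSelfSimilarEulerProfile (1 / (2 + ρ)) 0 V P') {κb a₀ p q : ℝ} (hκb : 0 < κb) (ha₀ : 0 < a₀)
    (hp0 : 0 ≤ p) (hpρ : p < ρ) (hq0 : 0 ≤ q) (hqρ : q < 2 + ρ + p)
    {x₀ : EuclideanSpace ℝ (Fin 3)} (hx₀ : curl V x₀ ≠ 0) {h : ℝ} (hh : h < selfSimilarBernoulli (1 / (2 + ρ)) 0 V P' x₀)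
    (hdef : ∃ R₀ : ℝ, ∀ y : EuclideanSpace ℝ (Fin 3), R₀ ≤ ‖y‖ →
      h < selfSimilarBernoulli (1 / (2 + ρ)) 0 V P' y → curl V y ≠ 0 →
        -(κb * ‖y‖ ^ (-p)) ≤ ⟪y, selfSimilarTransport (1 / (2 + ρ)) 0 V y⟫ → ⟪y, selfSimilarTransport (1 / (2 + ρ)) 0 V y⟫ ≤ 0 →
        a₀ * ‖y‖ ^ (-q) ≤ ‖selfSimilarTransport (1 / (2 + ρ)) 0 V y‖ ^ 2 +
          (1 / (2 + ρ)) * ⟪y, selfSimilarTransport (1 / (2 + ρ)) 0 V y⟫ +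
          ⟪y, fderiv ℝ V y (selfSimilarTransport (1 / (2 + ρ)) 0 V y)⟫) :
    ∀ c' : ℝ, 0 < c' → ∃ r : ℝ, 0 < r ∧ ∃ R₀ : ℝ,
      ∀ R : ℝ, R₀ ≤ R → ∀ (V' : EuclideanSpace ℝ (Fin 3) → EuclideanSpace ℝ (Fin 3)) (K Rbig : ℝ), ContDiff ℝ 2 V' →
        (∀ y, ‖fderiv ℝ V' y‖ ≤ K) → 2 * R < Rbig →
        (∀ w ∈ ball (0 : EuclideanSpace ℝ (Fin 3)) Rbig, V' w = V w) →
        (volume (ball x₀ r ∩ {y | ∀ σ ∈ Icc 0 (c' * R ^ (2 + ρ)),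
          ‖ODE.evolutionMap (fun _ : ℝ => selfSimilarTransport (1 / (2 + ρ)) 0 V') 0 (-σ) y‖ ≤ 2 * R})).toReal ≤
          (volume (ball x₀ r)).toReal / 2 := by
  obtain ⟨R₀, hR₀⟩ := hdef
  have hγ2 : 1 / (2 + ρ) ≤ 1 / 2 := one_div_le_one_div_of_le two_pos (by linarith)
  exact powerClockAt_of_invariantPowerBandDeficit hρ hρh hprof (O := {y | h < selfSimilarBernoulli (1 / (2 + ρ)) 0 V P' y})
    (isOpen_lt continuous_const hprof.contDiff_selfSimilarBernoulli.continuous)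
    (backwardInvariant_bernoulliSuperlevel hprof hγ2 h) hκb ha₀ hp0 hpρ hq0 hqρ (Rf := R₀)
    (fun y hyO hy1 hc hlo hhi => hR₀ y hy1 hyO hc hlo hhi) hh hx₀

end DriftClock

/-- **EXACTLY SELF-SIMILAR MEMBERS WITH A POWER-LAW BAND DEFICIT ABOVE ONE LEVEL THROUGH ONE VORTICAL POINT ARE TRIVIAL** (crux hypotheses verbatim, `0 < ρ ≤ ½`,
exact self-similarity about the origin, `V ∈ C²`; exponents `0 ≤ e₁ < ρ`, `0 ≤ e₂ < 2+ρ+e₁`).  Proof = classical pressure ⇒ `DriftClock.powerClockAt_of_powerBandDeficit_level`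
⇒ `NeedleRace.selfSimilar_ae_eq_zero_of_localPowerClockC2` («one clocked ball kills»). [folklore; ConstantinIgnatovaVicol2026Putative §3.4–§3.5] -/
theorem Loc.selfSimilar_ae_eq_zero_of_powerBandDeficitC2_level {ρ : ℝ} (hρ : 0 < ρ) (hρ1 : ρ ≤ 1 / 2)
    {u : ℝ → EuclideanSpace ℝ (Fin 3) → EuclideanSpace ℝ (Fin 3)} {p : ℝ → EuclideanSpace ℝ (Fin 3) → ℝ}
    {H : ℝ → EuclideanSpace ℝ (Fin 3) → EuclideanSpace ℝ (Fin 3) →L[ℝ] EuclideanSpace ℝ (Fin 3)} {c : ℝ≥0}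
    (hsw : IsSuitableWeakSolutionOn (slab (EuclideanSpace ℝ (Fin 3)) (Iio 0) isOpen_Iio) 0 0 u p)
    (hH : HasWeakSpatialGradientOn (slab (EuclideanSpace ℝ (Fin 3)) (Iio 0) isOpen_Iio) u H)
    (hgauge : ∀ a : ℝ, 0 < a →
      ENNReal.ofReal (a ^ (2 * ρ)) * cknA a (0 : ℝ × EuclideanSpace ℝ (Fin 3)) u +
          ENNReal.ofReal (a ^ ρ) * cknE a (0 : ℝ × EuclideanSpace ℝ (Fin 3)) H +
        ENNReal.ofReal (a ^ (2 * ρ)) * cknD a (0 : ℝ × EuclideanSpace ℝ (Fin 3)) p ≤ (c : ℝ≥0∞))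
    {V : EuclideanSpace ℝ (Fin 3) → EuclideanSpace ℝ (Fin 3)} {P : EuclideanSpace ℝ (Fin 3) → ℝ}
    (hu : ∀ τ : ℝ, τ < 0 → u τ = selfSimilarCollapse (1 / (2 + ρ)) 0 V τ)
    (hp : ∀ τ : ℝ, τ < 0 → p τ = selfSimilarCollapsePressure (1 / (2 + ρ)) 0 P τ)
    (hV : ContDiff ℝ 2 V) {κb a₀ e₁ e₂ : ℝ} (hκb : 0 < κb) (ha₀ : 0 < a₀)
    (he₁ : 0 ≤ e₁) (he₁ρ : e₁ < ρ) (he₂ : 0 ≤ e₂) (he₂ρ : e₂ < 2 + ρ + e₁)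
    (hB : ∀ P' : EuclideanSpace ℝ (Fin 3) → ℝ, IsSelfSimilarEulerProfile (1 / (2 + ρ)) 0 V P' →
      ∃ x₀ : EuclideanSpace ℝ (Fin 3), curl V x₀ ≠ 0 ∧ ∃ h : ℝ, h < selfSimilarBernoulli (1 / (2 + ρ)) 0 V P' x₀ ∧
        ∃ R₀ : ℝ, ∀ y : EuclideanSpace ℝ (Fin 3), R₀ ≤ ‖y‖ →
          h < selfSimilarBernoulli (1 / (2 + ρ)) 0 V P' y → curl V y ≠ 0 →
            -(κb * ‖y‖ ^ (-e₁)) ≤ ⟪y, selfSimilarTransport (1 / (2 + ρ)) 0 V y⟫ →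
            ⟪y, selfSimilarTransport (1 / (2 + ρ)) 0 V y⟫ ≤ 0 →
            a₀ * ‖y‖ ^ (-e₂) ≤ ‖selfSimilarTransport (1 / (2 + ρ)) 0 V y‖ ^ 2 +
              (1 / (2 + ρ)) * ⟪y, selfSimilarTransport (1 / (2 + ρ)) 0 V y⟫ +
              ⟪y, fderiv ℝ V y (selfSimilarTransport (1 / (2 + ρ)) 0 V y)⟫) :
    uncurry u =ᵐ[volume.restrict (Iio (0 : ℝ) ×ˢ (univ : Set (EuclideanSpace ℝ (Fin 3))))] 0 := by
  have hρ1' : ρ < 1 := by linarith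
  -- ### a classical pressure for the profile
  have hD : ∀ a : ℝ, 0 < a → ENNReal.ofReal (a ^ (2 * ρ)) *
      cknD a (0 : ℝ × EuclideanSpace ℝ (Fin 3)) p ≤ (c : ℝ≥0∞) :=
    fun a ha => le_trans le_add_self (hgauge a ha)
  have hpm : AEStronglyMeasurable (uncurry p)
      (volume.restrict (Iio (0 : ℝ) ×ˢ (univ : Set (EuclideanSpace ℝ (Fin 3))))) := by
    have := hsw.distributional.2.2.1.aestronglyMeasurable
    simpa [slab] using this
  have hPm := aestronglyMeasurable_pressureProfile hpm hp
  have hDprof := profile_pressure_weight_of_gaugeD hρ hρ1' hpm hp hD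
  have hP1 : LocallyIntegrable P volume :=
    EnergySaturation.locallyIntegrable_pressure_of_weight hρ1' hPm
      (ENNReal.mul_ne_top ENNReal.ofReal_ne_top ENNReal.coe_ne_top) hDprof
  obtain ⟨P', hprof⟩ :=
    WeakToClassical.exists_isSelfSimilarEulerProfile_of_contDiff hsw.distributional hu hp hV hP1
  -- ### the vortical point, its level, and the clock at that point
  obtain ⟨x₀, hx₀, h, hh, hdef⟩ := hB P' hprof
  have hclock := DriftClock.powerClockAt_of_powerBandDeficit_level hρ hρ1 hprof hκb ha₀ he₁ he₁ρ he₂ he₂ρ hx₀ hh hdef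
  -- ### «one clocked ball kills»
  exact NeedleRace.selfSimilar_ae_eq_zero_of_localPowerClockC2 hρ hρ1 hsw hH hgauge hu hp hV
    (fun c' hc' => ⟨x₀, hclock c' hc'⟩)

namespace Past

variable {ρ T T₁ : ℝ}
  {u : ℝ → EuclideanSpace ℝ (Fin 3) → EuclideanSpace ℝ (Fin 3)} {p : ℝ → EuclideanSpace ℝ (Fin 3) → ℝ}
  {H : ℝ → EuclideanSpace ℝ (Fin 3) → EuclideanSpace ℝ (Fin 3) →L[ℝ] EuclideanSpace ℝ (Fin 3)} {c : ℝ≥0}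
  {V : EuclideanSpace ℝ (Fin 3) → EuclideanSpace ℝ (Fin 3)} {P : EuclideanSpace ℝ (Fin 3) → ℝ}

/-- **PAST-EXACT MEMBER WITH A POWER-LAW BAND DEFICIT ABOVE ONE LEVEL THROUGH ONE VORTICAL POINT IS TRIVIAL** (crux hypotheses verbatim, `0 < ρ ≤ ½`; exact
self-similarity about `(T, x₀)` for `τ < T₁`, `T₁ ≤ 0`, `T₁ ≤ T`; `V ∈ C²`; the vortical point of the profile is `x₁`).  Proof = `Past.exists_isSelfSimilarEulerProfile` ⇒
`DriftClock.powerClockAt_of_powerBandDeficit_level` ⇒ `NeedleRace.selfSimilar_ae_eq_zero_of_localPowerClockC2_past`. [folklore; ConstantinIgnatovaVicol2026Putative §3.4–§3.5] -/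
theorem selfSimilar_ae_eq_zero_of_powerBandDeficitC2_level_past (hρ : 0 < ρ) (hρh : ρ ≤ 1 / 2) (hT₁ : T₁ ≤ 0)
    (hTT₁ : T₁ ≤ T) (x₀ : EuclideanSpace ℝ (Fin 3))
    (hsw : IsSuitableWeakSolutionOn (slab (EuclideanSpace ℝ (Fin 3)) (Iio 0) isOpen_Iio) 0 0 u p)
    (hH : HasWeakSpatialGradientOn (slab (EuclideanSpace ℝ (Fin 3)) (Iio 0) isOpen_Iio) u H)
    (hgauge : ∀ a : ℝ, 0 < a →
      ENNReal.ofReal (a ^ (2 * ρ)) * cknA a (0 : ℝ × EuclideanSpace ℝ (Fin 3)) u +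
          ENNReal.ofReal (a ^ ρ) * cknE a (0 : ℝ × EuclideanSpace ℝ (Fin 3)) H +
        ENNReal.ofReal (a ^ (2 * ρ)) * cknD a (0 : ℝ × EuclideanSpace ℝ (Fin 3)) p ≤ (c : ℝ≥0∞))
    (hu : ∀ τ : ℝ, τ < T₁ → u τ = fun x => selfSimilarCollapse (1 / (2 + ρ)) T V τ (x - x₀))
    (hp : ∀ τ : ℝ, τ < T₁ → p τ = fun x => selfSimilarCollapsePressure (1 / (2 + ρ)) T P τ (x - x₀))
    (hV : ContDiff ℝ 2 V) {κb a₀ e₁ e₂ : ℝ} (hκb : 0 < κb) (ha₀ : 0 < a₀)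
    (he₁ : 0 ≤ e₁) (he₁ρ : e₁ < ρ) (he₂ : 0 ≤ e₂) (he₂ρ : e₂ < 2 + ρ + e₁)
    (hB : ∀ P' : EuclideanSpace ℝ (Fin 3) → ℝ, IsSelfSimilarEulerProfile (1 / (2 + ρ)) 0 V P' →
      ∃ x₁ : EuclideanSpace ℝ (Fin 3), curl V x₁ ≠ 0 ∧ ∃ h : ℝ, h < selfSimilarBernoulli (1 / (2 + ρ)) 0 V P' x₁ ∧
        ∃ R₀ : ℝ, ∀ y : EuclideanSpace ℝ (Fin 3), R₀ ≤ ‖y‖ →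
          h < selfSimilarBernoulli (1 / (2 + ρ)) 0 V P' y → curl V y ≠ 0 →
            -(κb * ‖y‖ ^ (-e₁)) ≤ ⟪y, selfSimilarTransport (1 / (2 + ρ)) 0 V y⟫ →
            ⟪y, selfSimilarTransport (1 / (2 + ρ)) 0 V y⟫ ≤ 0 →
            a₀ * ‖y‖ ^ (-e₂) ≤ ‖selfSimilarTransport (1 / (2 + ρ)) 0 V y‖ ^ 2 +
              (1 / (2 + ρ)) * ⟪y, selfSimilarTransport (1 / (2 + ρ)) 0 V y⟫ +
              ⟪y, fderiv ℝ V y (selfSimilarTransport (1 / (2 + ρ)) 0 V y)⟫) :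
    uncurry u =ᵐ[volume.restrict (Iio (0 : ℝ) ×ˢ (univ : Set (EuclideanSpace ℝ (Fin 3))))] 0 := by
  -- ### a classical pressure for the profile (far-past extension)
  obtain ⟨P', hprof⟩ := exists_isSelfSimilarEulerProfile hρ hT₁ hTT₁ hsw.distributional hu hp hV
  -- ### the vortical point, its level, and the clock at that point
  obtain ⟨x₁, hx₁, h, hh, hdef⟩ := hB P' hprof
  have hclock := DriftClock.powerClockAt_of_powerBandDeficit_level hρ hρh hprof hκb ha₀ he₁ he₁ρ he₂ he₂ρ hx₁ hh hdef
  -- ### «one clocked ball kills» (past twin)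
  exact NeedleRace.selfSimilar_ae_eq_zero_of_localPowerClockC2_past hρ hρh hT₁ hTT₁ x₀ hsw hH hgauge hu hp hV
    (fun c' hc' => ⟨x₁, hclock c' hc'⟩)

end Past

end Summit.NavierStokesRegularity.NavierStokesRegularity.Theorems.PowerGaugeEulerLiouville

end
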